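import Literature.Probability.RandomPlanarGeometry.HexSAWBrickWallBridgeEnvelope
import Literature.Probability.RandomPlanarGeometry.SAWBridgeDivergence
import Mathlib.Algebra.Order.BigOperators.Group.Finset
import Mathlib.Analysis.SpecialFunctions.Log.Basic
import HarnessLib

/-!
# The brick-wall bridge generating function of the hexagonal lattice diverges at `1/μ_ℍ`:
# `Σ_n b_n(ℍ) μ_ℍ^{-n} = +∞` (Kesten 1963 / Madras–Slade Corollary 3.1.8 on `ℍ`)

Topic `Literature/Probability/RandomPlanarGeometry` (continues `HexSAWBrickWallWalks.lean` /
`HexSAWBrickWallBridgeEnvelope.lean`: honeycomb walks `HexBW.saws n ⊆ Zd.saws 2 n` in brick-wall coordinates,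
height = coordinate `0`, `HexBW.bridges`, `HexBW.halfSpaceWalks`, the parity twist `twistAt` / `twistWalk`; and
the tree's `ℤ^d` file `SAWBridgeDivergence.lean`, whose graph-free pieces `Zd.spanHead`, `Zd.spanTail`,
`Zd.eq_of_pieces_eq`, `Zd.tailWalk`, `Zd.headWalk`, `Zd.sum_range_triangle_le` are used AS IS).

Source: N. Madras, G. Slade, *The Self-Avoiding Walk* (1993), proof of Corollary 3.1.8, pp. 61–62 (every
half-space walk decomposes into bridges of strictly decreasing spans, injectively, whence (3.1.12)
`Σ_N h_N z^N ≤ ∏_A (1 + Σ_m b_{m,A} z^m) ≤ exp(B_z − 1)`, with the first inequality of (3.1.7)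
`c_N ≤ Σ_m h_{m+1} h_{N−m}` this gives (3.1.13) `Σ_N c_N z^N ≤ z^{-1} e^{2(B_z−1)}`, and the left side
diverges at `z_c = 1/μ`), §3.4 Notes p. 75 (due to Kesten 1963); T. Hutchcroft, ECP 23 (2018), Prop. 2.1.
Printed for `ℤ^d`; the same words prove it for the brick-wall bridges of `ℍ` once the parity twist is
inserted wherever a piece of a walk is read from a site of odd parity.  Lane «pcv-sawmu», input K4 of route
R84 «HEX-HALFSPACE-RATIO-1» (the Lawler–Schramm–Werner renewal argument needs `B(1/μ_ℍ) = ∞`).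

## Contents (namespace `Literature.Probability.RandomPlanarGeometry.SAW.HexBW`, all PROVED)

* the cut at the LAST MINIMUM with the twist: `tail`, `head`, `tail_mem`, `head_mem`,
  **`card_saws_le_sum_halfSpaceCount : c_n(ℍ) ≤ Σ_{m≤n} h_{m+1}(ℍ) h_{n−m}(ℍ)`** ((3.1.7), first line;
  also as `hexSawCount_le_sum_halfSpaceCount_bw` — the suffix `_bw` there and on `card_hsSpan_le_bw` below keeps the
  names distinct from the independently landed `HexSAWBrickWallHalfSpaceDecomposition.lean`, which proves the same
  two inequalities with inline filters under the unsuffixed names);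
* the cut at the LAST MAXIMUM with the twist: `spanTail`, `spanTail_mem`, `maxLevel_spanTail_lt`,
  `eq_of_pieces_eq`, `hsSpan`, `hsSpanLT`, `brSpan`, **`card_hsSpan_le_bw`** ((3.1.12), one-step form);
* truncated generating functions `hsLTGF`, `brGF`, `bridgeGFpos`, `T_le_exp`, `sum_halfSpaceCount_le_exp`
  (`Σ_{n≤M} h_n z^n ≤ exp(Σ_{1≤n≤M} b_n z^n)`), **`sum_hexSawCount_le_exp`** ((3.1.13), finite form),
  **`half_log_le_sum_bridgeCount`** ((3.1.14): `Σ_{n=1}^{M+1} b_n μ_ℍ^{-n} ≥ ½ log((M+1)/μ_ℍ)`), and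
  **`not_summable_bridgeCount_div_pow : ¬ Summable (fun n => (bridgeCount n : ℝ) / hexConnectiveConstant ^ n)`**.
-/

noncomputable section

open Finset Filter Topology Literature.Probability.LatticeModels Literature.Probability.Percolation
open scoped BigOperators

namespace Literature.Probability.RandomPlanarGeometry.SAW

namespace HexBW

/-! ### The twist commutes with the height reflection; twisted walks -/

/-- `twistAt p` (acting on coordinate `1`) commutes with the height reflection `R₀` (acting on coordinate `0`).
[cite: MadrasSlade1993, §3.1] -/
theorem twistAt_reflCoord (p : Site 2) (ℓ : ℤ) (z : Site 2) :
    twistAt p (Zd.reflCoord ℓ z) = Zd.reflCoord ℓ (twistAt p z) := by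
  unfold twistAt
  split_ifs
  · rfl
  · funext j
    fin_cases j
    · simp [Zd.reflCoord_apply_zero]
    · simp [negY]

/-- A twisted `ℤ²` half-space walk is a `ℤ²` half-space walk. [cite: MadrasSlade1993, Definition 3.1.2] -/
theorem twistWalk_mem_zdHalfSpaceWalks {n : ℕ} {ω : ℕ → Site 2} (hω : ω ∈ Zd.halfSpaceWalks 2 n) (p : Site 2) :
    twistWalk p ω ∈ Zd.halfSpaceWalks 2 n := by
  obtain ⟨hs, hh⟩ := Zd.mem_halfSpaceWalks.1 hω
  refine Zd.mem_halfSpaceWalks.2 ⟨twistWalk_mem_zd hs p, fun i h1 h2 => ?_⟩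
  rw [twistWalk_apply_zero, twistWalk_apply_zero]
  exact hh i h1 h2

/-- The twist does not change the maximal height. [cite: MadrasSlade1993, §3.1] -/
theorem maxLevel_twistWalk (n : ℕ) (p : Site 2) (ω : ℕ → Site 2) :
    Zd.maxLevel n (twistWalk p ω) = Zd.maxLevel n ω :=
  Zd.maxLevel_congr fun i _ => twistWalk_apply_zero p ω i

/-! ### Cutting at the last minimum: `c_n(ℍ) ≤ Σ_{m=0}^{n} h_{m+1}(ℍ) · h_{n−m}(ℍ)` -/

/-- The part of `ω` after the last minimum `m` of the height, read at the origin from `ω m` (twisted).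
[cite: MadrasSlade1993, §3.1, proof of Theorem 3.1.1, eq. (3.1.7)] -/
def tail (n : ℕ) (ω : ℕ → Site 2) : ℕ → Site 2 := twistWalk (ω (Zd.lastMin n ω)) (Zd.tailWalk n ω)

/-- The part of `ω` up to the last minimum `m`, reversed, preceded by a step `−e₀`, read at the origin from
`ω m − e₀` (twisted). [cite: MadrasSlade1993, §3.1, proof of Theorem 3.1.1, eq. (3.1.7)] -/
def head (n : ℕ) (ω : ℕ → Site 2) : ℕ → Site 2 :=
  twistWalk (ω (Zd.lastMin n ω) - Pi.single 0 1) (Zd.headWalk n ω)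

/-- The tail piece is a honeycomb half-space walk. [cite: MadrasSlade1993, §3.1, proof of Theorem 3.1.1] -/
theorem tail_mem {n : ℕ} {ω : ℕ → Site 2} (hω : ω ∈ saws n) :
    tail n ω ∈ halfSpaceWalks (n - Zd.lastMin n ω) := by
  obtain ⟨hZ, hbw⟩ := mem_saws.1 hω
  have hT := twistWalk_mem_zdHalfSpaceWalks (Zd.tailWalk_mem hZ) (ω (Zd.lastMin n ω))
  obtain ⟨hTs, hTh⟩ := Zd.mem_halfSpaceWalks.1 hT
  obtain ⟨m, hm⟩ : ∃ m, Zd.lastMin n ω = m := ⟨_, rfl⟩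
  have hmn : m ≤ n := hm ▸ Zd.lastMin_le n ω
  refine mem_halfSpaceWalks.2 ⟨mem_saws.2 ⟨hTs, fun i hi => ?_⟩, hTh⟩
  rw [hm] at hi
  show brickWallGraph.Adj (twistAt (ω (Zd.lastMin n ω)) (Zd.tailWalk n ω i))
    (twistAt (ω (Zd.lastMin n ω)) (Zd.tailWalk n ω (i + 1)))
  rw [hm, Zd.tailWalk_apply hm, Zd.tailWalk_apply hm, min_eq_left hi.le,
    min_eq_left (by omega : i + 1 ≤ n - m), ← add_assoc, adj_twistAt_sub_iff]
  exact hbw (m + i) (by omega)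

/-- The head piece is a honeycomb half-space walk. [cite: MadrasSlade1993, §3.1, proof of Theorem 3.1.1] -/
theorem head_mem {n : ℕ} {ω : ℕ → Site 2} (hω : ω ∈ saws n) :
    head n ω ∈ halfSpaceWalks (Zd.lastMin n ω + 1) := by
  obtain ⟨hZ, hbw⟩ := mem_saws.1 hω
  set q : Site 2 := ω (Zd.lastMin n ω) - Pi.single 0 1 with hq
  have hT := twistWalk_mem_zdHalfSpaceWalks (Zd.headWalk_mem hZ) q
  obtain ⟨hTs, hTh⟩ := Zd.mem_halfSpaceWalks.1 hT
  obtain ⟨m, hm⟩ : ∃ m, Zd.lastMin n ω = m := ⟨_, rfl⟩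
  have hmn : m ≤ n := hm ▸ Zd.lastMin_le n ω
  have hqm : ω m = q + Pi.single 0 1 := by rw [hq, hm, sub_add_cancel]
  -- every value of the head piece (from time `1` on) is `ω(·) − q`
  have hval : ∀ i, 1 ≤ i → Zd.headWalk n ω i = ω (m + 1 - min i (m + 1)) - q := fun i hi => by
    rw [Zd.headWalk_apply hm, if_neg (by omega), hq, hm]
    abel
  refine mem_halfSpaceWalks.2 ⟨mem_saws.2 ⟨hTs, fun i hi => ?_⟩, hTh⟩
  rw [hm] at hi
  show brickWallGraph.Adj (twistAt q (Zd.headWalk n ω i)) (twistAt q (Zd.headWalk n ω (i + 1)))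
  rcases Nat.eq_zero_or_pos i with rfl | hipos
  · -- the first step `0 → e₀`, read from `q`: `q → q + e₀ = ω m`
    have h0 : Zd.headWalk n ω 0 = q - q := by rw [Zd.headWalk_apply hm, if_pos rfl, sub_self]
    rw [h0, hval 1 le_rfl, min_eq_left (by omega : 1 ≤ m + 1), show m + 1 - 1 = m by omega, hqm,
      adj_twistAt_sub_iff]
    exact adj_add_single q
  · rw [hval i hipos, hval (i + 1) (by omega), min_eq_left (by omega : i ≤ m + 1),
      min_eq_left (by omega : i + 1 ≤ m + 1), adj_twistAt_sub_iff,
      show m + 1 - i = (m + 1 - (i + 1)) + 1 by omega]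
    exact (hbw (m + 1 - (i + 1)) (by omega)).symm

/-- **`c_n(ℍ) ≤ Σ_{m=0}^{n} h_{m+1}(ℍ) · h_{n−m}(ℍ)`**: cut at the last minimum of the height; the walk is
recovered from `m` and the two (twisted) pieces — the twists are determined by the parity of `m`.
[cite: MadrasSlade1993, §3.1, eq. (3.1.7)] -/
theorem card_saws_le_sum_halfSpaceCount (n : ℕ) :
    #(saws n) ≤ ∑ m ∈ Finset.range (n + 1), halfSpaceCount (m + 1) * halfSpaceCount (n - m) := by
  classical
  have hcard : ((Finset.range (n + 1)).sigma
      fun m => halfSpaceWalks (m + 1) ×ˢ halfSpaceWalks (n - m)).card =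
      ∑ m ∈ Finset.range (n + 1), halfSpaceCount (m + 1) * halfSpaceCount (n - m) := by
    rw [Finset.card_sigma]
    simp_rw [Finset.card_product]
    rfl
  rw [← hcard]
  refine Finset.card_le_card_of_injOn
    (fun ω => (⟨Zd.lastMin n ω, (head n ω, tail n ω)⟩ : Σ _ : ℕ, (ℕ → Site 2) × (ℕ → Site 2))) ?_ ?_
  · intro ω hω
    rw [Finset.mem_coe] at hω
    rw [Finset.mem_coe, Finset.mem_sigma, Finset.mem_range, Finset.mem_product]
    exact ⟨Nat.lt_succ_of_le (Zd.lastMin_le n ω), head_mem hω, tail_mem hω⟩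
  · intro ω hω ω' hω' h
    rw [Finset.mem_coe] at hω hω'
    simp only [Sigma.mk.inj_iff] at h
    obtain ⟨hmm, h⟩ := h
    have h' : (head n ω, tail n ω) = (head n ω', tail n ω') := eq_of_heq h
    simp only [Prod.mk.injEq] at h'
    obtain ⟨hh, ht⟩ := h'
    obtain ⟨h0, hend, -, hinj⟩ := mem_saws_iff.1 hω
    obtain ⟨h0', hend', -, hinj'⟩ := mem_saws_iff.1 hω'
    obtain ⟨m, hm⟩ : ∃ m, Zd.lastMin n ω = m := ⟨_, rfl⟩
    have hm' : Zd.lastMin n ω' = m := hmm.symm.trans hm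
    have hmn : m ≤ n := hm ▸ Zd.lastMin_le n ω
    -- the twists agree (parity of `ω m`, `ω' m` is that of `m`)
    have hpar : (ω m 0 + ω m 1) % 2 = (ω' m 0 + ω' m 1) % 2 := by
      rw [parity_apply hω hmn, parity_apply hω' hmn]
    have hparq : ∀ z : Site 2, twistAt (ω m - Pi.single 0 1) z = twistAt (ω' m - Pi.single 0 1) z := by
      intro z
      refine twistAt_congr ?_ z
      have h1 : (1 : Fin 2) ≠ 0 := by decide
      simp only [Pi.sub_apply, Pi.single_eq_same, Pi.single_eq_of_ne h1]
      omega
    have hh' : Zd.headWalk n ω = Zd.headWalk n ω' := by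
      refine twistWalk_injective (ω m - Pi.single 0 1) ?_
      have e1 : head n ω = twistWalk (ω m - Pi.single 0 1) (Zd.headWalk n ω) := by rw [head, hm]
      have e2 : head n ω' = twistWalk (ω m - Pi.single 0 1) (Zd.headWalk n ω') := by
        rw [head, hm']
        exact funext fun i => (hparq _).symm
      rw [← e1, ← e2]
      exact hh
    have ht' : Zd.tailWalk n ω = Zd.tailWalk n ω' := by
      refine twistWalk_injective (ω m) ?_
      have e1 : tail n ω = twistWalk (ω m) (Zd.tailWalk n ω) := by rw [tail, hm]
      have e2 : tail n ω' = twistWalk (ω m) (Zd.tailWalk n ω') := by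
        rw [tail, hm']
        exact funext fun i => (twistAt_congr hpar _).symm
      rw [← e1, ← e2]
      exact ht
    -- now the tree's recovery argument, verbatim
    have hωm : ω m = ω' m := by
      have := congrFun hh' (m + 1)
      rw [Zd.headWalk_apply hm, Zd.headWalk_apply hm', if_neg (by omega), if_neg (by omega), min_self,
        Nat.sub_self, h0, h0', add_left_inj, zero_sub, zero_sub, neg_inj] at this
      exact this
    funext i
    rcases le_or_gt i m with hi | hi
    · rcases Nat.eq_zero_or_pos (m - i) with h | h
      · have : i = m := by omega
        rw [this, hωm]
      · have := congrFun hh' (m + 1 - i)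
        rw [Zd.headWalk_apply hm, Zd.headWalk_apply hm', if_neg (by omega), if_neg (by omega),
          min_eq_left (by omega : m + 1 - i ≤ m + 1), show m + 1 - (m + 1 - i) = i by omega,
          hωm, add_left_inj, sub_left_inj] at this
        exact this
    · rcases le_or_gt i n with hin | hin
      · have := congrFun ht' (i - m)
        rw [Zd.tailWalk_apply hm, Zd.tailWalk_apply hm', min_eq_left (by omega : i - m ≤ n - m),
          show m + (i - m) = i by omega, hωm, sub_left_inj] at this
        exact this
      · have := congrFun ht' (n - m)
        rw [Zd.tailWalk_apply hm, Zd.tailWalk_apply hm', min_self, show m + (n - m) = n by omega, hωm,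
          sub_left_inj] at this
        rw [hend i hin.le, hend' i hin.le, this]

/-- `c_n(ℍ) ≤ Σ_{m=0}^{n} h_{m+1}(ℍ) h_{n−m}(ℍ)` with `hexSawCount`. [cite: MadrasSlade1993, §3.1, eq. (3.1.7)] -/
theorem hexSawCount_le_sum_halfSpaceCount_bw (n : ℕ) :
    hexSawCount n ≤ ∑ m ∈ Finset.range (n + 1), halfSpaceCount (m + 1) * halfSpaceCount (n - m) := by
  rw [← card_saws]
  exact card_saws_le_sum_halfSpaceCount n

/-! ### Cutting a half-space walk at the last maximum (span decomposition) -/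

/-- The piece of `ω` after the last maximum `m`, read at the origin from `ω m` (twisted) and reflected in the
height: a half-space walk of span `< A₁(ω)`. [cite: MadrasSlade1993, §3.1, proof of Corollary 3.1.8 (eq. (3.1.12))] -/
def spanTail (n : ℕ) (ω : ℕ → Site 2) : ℕ → Site 2 := twistWalk (ω (Zd.lastArgmax n ω)) (Zd.spanTail n ω)

/-- The head piece `Zd.spanHead` of a honeycomb half-space walk is a honeycomb bridge of span `A₁(ω)`.
[cite: MadrasSlade1993, §3.1, proof of Proposition 3.1.5 / Corollary 3.1.8] -/
theorem spanHead_mem {n : ℕ} {ω : ℕ → Site 2} (hω : ω ∈ halfSpaceWalks n) :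
    Zd.spanHead n ω ∈ bridges (Zd.lastArgmax n ω) ∧
      Zd.spanHead n ω (Zd.lastArgmax n ω) 0 = Zd.maxLevel n ω := by
  obtain ⟨hZ, hZA⟩ := Zd.spanHead_mem (halfSpaceWalks_subset_zd n hω)
  obtain ⟨hZs, hZb⟩ := Zd.mem_bridges.1 hZ
  obtain ⟨-, hbw⟩ := mem_saws.1 (mem_halfSpaceWalks.1 hω).1
  obtain ⟨m, hm⟩ : ∃ m, Zd.lastArgmax n ω = m := ⟨_, rfl⟩
  have hmn : m ≤ n := hm ▸ (Zd.lastArgmax_spec n ω).1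
  refine ⟨mem_bridges.2 ⟨mem_saws.2 ⟨hZs, fun i hi => ?_⟩, hZb⟩, hZA⟩
  rw [hm] at hi
  rw [Zd.spanHead_apply hm, Zd.spanHead_apply hm, min_eq_left hi.le, min_eq_left (by omega : i + 1 ≤ m)]
  exact hbw i (by omega)

/-- The tail piece is a honeycomb half-space walk. [cite: MadrasSlade1993, §3.1, proof of Corollary 3.1.8] -/
theorem spanTail_mem {n : ℕ} {ω : ℕ → Site 2} (hω : ω ∈ halfSpaceWalks n) :
    spanTail n ω ∈ halfSpaceWalks (n - Zd.lastArgmax n ω) := by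
  have hT := twistWalk_mem_zdHalfSpaceWalks (Zd.spanTail_mem (halfSpaceWalks_subset_zd n hω))
    (ω (Zd.lastArgmax n ω))
  obtain ⟨hTs, hTh⟩ := Zd.mem_halfSpaceWalks.1 hT
  obtain ⟨-, hbw⟩ := mem_saws.1 (mem_halfSpaceWalks.1 hω).1
  obtain ⟨m, hm⟩ : ∃ m, Zd.lastArgmax n ω = m := ⟨_, rfl⟩
  have hmn : m ≤ n := hm ▸ (Zd.lastArgmax_spec n ω).1
  refine mem_halfSpaceWalks.2 ⟨mem_saws.2 ⟨hTs, fun i hi => ?_⟩, hTh⟩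
  rw [hm] at hi
  show brickWallGraph.Adj (twistAt (ω (Zd.lastArgmax n ω)) (Zd.spanTail n ω i))
    (twistAt (ω (Zd.lastArgmax n ω)) (Zd.spanTail n ω (i + 1)))
  rw [hm, Zd.spanTail_apply hm, Zd.spanTail_apply hm, min_eq_left hi.le,
    min_eq_left (by omega : i + 1 ≤ n - m), twistAt_reflCoord, twistAt_reflCoord, adj_reflCoord_iff,
    ← add_assoc, adj_twistAt_sub_iff]
  exact hbw (m + i) (by omega)

/-- The tail piece has span `< A₁(ω)` (if `A₁(ω) ≥ 1`). [cite: MadrasSlade1993, §3.1, proof of Corollary 3.1.8 ("A₁ > A₂ > …")] -/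
theorem maxLevel_spanTail_lt {n : ℕ} {ω : ℕ → Site 2} (hω : ω ∈ halfSpaceWalks n)
    (hA : 1 ≤ Zd.maxLevel n ω) :
    Zd.maxLevel (n - Zd.lastArgmax n ω) (spanTail n ω) < Zd.maxLevel n ω := by
  rw [spanTail, maxLevel_twistWalk]
  exact Zd.maxLevel_spanTail_lt (halfSpaceWalks_subset_zd n hω) hA

/-- The walk is recovered from `n₁`, the head piece and the tail piece (the twist is fixed by the parity of
`n₁`). [cite: MadrasSlade1993, §3.1, proof of Corollary 3.1.8 ("the sequence of bridges uniquely determines the original half-space walk")] -/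
theorem eq_of_pieces_eq {n : ℕ} {ω ω' : ℕ → Site 2} (hω : ω ∈ saws n) (hω' : ω' ∈ saws n)
    (hmm : Zd.lastArgmax n ω = Zd.lastArgmax n ω') (hh : Zd.spanHead n ω = Zd.spanHead n ω')
    (ht : spanTail n ω = spanTail n ω') : ω = ω' := by
  obtain ⟨m, hm⟩ : ∃ m, Zd.lastArgmax n ω = m := ⟨_, rfl⟩
  have hm' : Zd.lastArgmax n ω' = m := hmm.symm.trans hm
  have hmn : m ≤ n := hm ▸ (Zd.lastArgmax_spec n ω).1
  have hpar : (ω m 0 + ω m 1) % 2 = (ω' m 0 + ω' m 1) % 2 := by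
    rw [parity_apply hω hmn, parity_apply hω' hmn]
  have ht' : Zd.spanTail n ω = Zd.spanTail n ω' := by
    refine twistWalk_injective (ω m) ?_
    have e1 : spanTail n ω = twistWalk (ω m) (Zd.spanTail n ω) := by rw [spanTail, hm]
    have e2 : spanTail n ω' = twistWalk (ω m) (Zd.spanTail n ω') := by
      rw [spanTail, hm']
      exact funext fun i => (twistAt_congr hpar _).symm
    rw [← e1, ← e2]
    exact ht
  exact Zd.eq_of_pieces_eq (saws_subset n hω) (saws_subset n hω') hmm hh ht'

open Classical in
/-- Honeycomb half-space walks of length `n` and span `A`. [cite: MadrasSlade1993, Definition 3.1.3] -/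
def hsSpan (n : ℕ) (A : ℤ) : Finset (ℕ → Site 2) := (halfSpaceWalks n).filter fun ω => Zd.maxLevel n ω = A

open Classical in
/-- Honeycomb half-space walks of length `n` and span `< A`. [cite: MadrasSlade1993, Definition 3.1.3] -/
def hsSpanLT (n : ℕ) (A : ℤ) : Finset (ℕ → Site 2) := (halfSpaceWalks n).filter fun ω => Zd.maxLevel n ω < A

open Classical in
/-- Honeycomb bridges of length `n` and span `A` (the height of the endpoint). [cite: MadrasSlade1993, Definition 3.1.3] -/
def brSpan (n : ℕ) (A : ℤ) : Finset (ℕ → Site 2) := (bridges n).filter fun ω => ω n 0 = A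

/-- **`h_{n,A} ≤ Σ_{m=0}^{n} b_{m,A} · h^{<A}_{n−m}`** for `A ≥ 1` (one-step form of (3.1.12) on `ℍ`).
[cite: MadrasSlade1993, §3.1, proof of Corollary 3.1.8, eq. (3.1.12)] -/
theorem card_hsSpan_le_bw (n : ℕ) {A : ℤ} (hA : 1 ≤ A) :
    (hsSpan n A).card ≤ ∑ m ∈ Finset.range (n + 1), (brSpan m A).card * (hsSpanLT (n - m) A).card := by
  classical
  have hcard : ((Finset.range (n + 1)).sigma fun m => brSpan m A ×ˢ hsSpanLT (n - m) A).card =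
      ∑ m ∈ Finset.range (n + 1), (brSpan m A).card * (hsSpanLT (n - m) A).card := by
    rw [Finset.card_sigma]; simp_rw [Finset.card_product]
  rw [← hcard]
  refine Finset.card_le_card_of_injOn
    (fun ω => (⟨Zd.lastArgmax n ω, (Zd.spanHead n ω, spanTail n ω)⟩ :
      Σ _ : ℕ, (ℕ → Site 2) × (ℕ → Site 2))) ?_ ?_
  · intro ω hω
    rw [Finset.mem_coe, hsSpan, Finset.mem_filter] at hω
    obtain ⟨hω, hspan⟩ := hω
    rw [Finset.mem_coe, Finset.mem_sigma, Finset.mem_range, Finset.mem_product, brSpan,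
      Finset.mem_filter, hsSpanLT, Finset.mem_filter]
    obtain ⟨hhead, hheadA⟩ := spanHead_mem hω
    dsimp only
    refine ⟨Nat.lt_succ_of_le (Zd.lastArgmax_spec n ω).1, ⟨hhead, ?_⟩, spanTail_mem hω, ?_⟩
    · rw [hheadA, hspan]
    · rw [← hspan]
      exact maxLevel_spanTail_lt hω (hspan ▸ hA)
  · intro ω hω ω' hω' h
    rw [Finset.mem_coe, hsSpan, Finset.mem_filter] at hω hω'
    simp only [Sigma.mk.inj_iff] at h
    obtain ⟨hmm, h⟩ := h
    have h' : (Zd.spanHead n ω, spanTail n ω) = (Zd.spanHead n ω', spanTail n ω') := eq_of_heq h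
    simp only [Prod.mk.injEq] at h'
    exact eq_of_pieces_eq (mem_halfSpaceWalks.1 hω.1).1 (mem_halfSpaceWalks.1 hω'.1).1 hmm h'.1 h'.2

/-! ### Generating functions, truncated at length `M` -/

/-- `T_M(A) = Σ_{n≤M} h^{<A}_n(ℍ) zⁿ`. [cite: MadrasSlade1993, §3.1, proof of Corollary 3.1.8] -/
def hsLTGF (M : ℕ) (z : ℝ) (A : ℤ) : ℝ :=
  ∑ n ∈ Finset.range (M + 1), ((hsSpanLT n A).card : ℝ) * z ^ n

/-- `V_M(A) = Σ_{n≤M} b_{n,A}(ℍ) zⁿ`. [cite: MadrasSlade1993, §3.1, proof of Corollary 3.1.8] -/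
def brGF (M : ℕ) (z : ℝ) (A : ℤ) : ℝ :=
  ∑ n ∈ Finset.range (M + 1), ((brSpan n A).card : ℝ) * z ^ n

/-- `B⁺_M(z) = Σ_{1≤n≤M} b_n(ℍ) zⁿ` (truncation of `B_z − 1`). [cite: MadrasSlade1993, Definition 3.1.7] -/
def bridgeGFpos (M : ℕ) (z : ℝ) : ℝ :=
  ∑ n ∈ Finset.range (M + 1), if n = 0 then 0 else (bridgeCount n : ℝ) * z ^ n

/-- `T_M(A+1) = T_M(A) + Σ_{n≤M} h_{n,A} zⁿ`. [cite: MadrasSlade1993, §3.1, proof of Corollary 3.1.8] -/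
theorem hsLTGF_succ (M : ℕ) (z : ℝ) (A : ℤ) :
    hsLTGF M z (A + 1) = hsLTGF M z A + ∑ n ∈ Finset.range (M + 1), ((hsSpan n A).card : ℝ) * z ^ n := by
  classical
  rw [hsLTGF, hsLTGF, ← Finset.sum_add_distrib]
  refine Finset.sum_congr rfl fun n _ => ?_
  rw [← add_mul]
  congr 1
  have : hsSpanLT n (A + 1) = hsSpanLT n A ∪ hsSpan n A := by
    ext ω
    simp only [hsSpanLT, hsSpan, Finset.mem_union, Finset.mem_filter]
    constructor
    · rintro ⟨h, hlt⟩
      rcases lt_or_eq_of_le (Int.lt_add_one_iff.1 hlt) with h1 | h1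
      · exact Or.inl ⟨h, h1⟩
      · exact Or.inr ⟨h, h1⟩
    · rintro (⟨h, h1⟩ | ⟨h, h1⟩)
      · exact ⟨h, by omega⟩
      · exact ⟨h, by omega⟩
  rw [this, Finset.card_union_of_disjoint, Nat.cast_add]
  exact Finset.disjoint_filter.2 fun ω _ h1 h2 => by omega

/-- The recursion `Σ_{n≤M} h_{n,A} zⁿ ≤ V_M(A) · T_M(A)` (`A ≥ 1`, `z ≥ 0`).
[cite: MadrasSlade1993, §3.1, proof of Corollary 3.1.8 (eq. (3.1.12))] -/
theorem sum_hsSpan_le (M : ℕ) {z : ℝ} (hz : 0 ≤ z) {A : ℤ} (hA : 1 ≤ A) :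
    ∑ n ∈ Finset.range (M + 1), ((hsSpan n A).card : ℝ) * z ^ n ≤ brGF M z A * hsLTGF M z A := by
  calc ∑ n ∈ Finset.range (M + 1), ((hsSpan n A).card : ℝ) * z ^ n
      ≤ ∑ n ∈ Finset.range (M + 1), ∑ m ∈ Finset.range (n + 1),
          (((brSpan m A).card : ℝ) * z ^ m) * (((hsSpanLT (n - m) A).card : ℝ) * z ^ (n - m)) := by
        refine Finset.sum_le_sum fun n hn => ?_
        have h1 : ((hsSpan n A).card : ℝ) ≤
            ∑ m ∈ Finset.range (n + 1), ((brSpan m A).card : ℝ) * (hsSpanLT (n - m) A).card := by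
          exact_mod_cast card_hsSpan_le_bw n hA
        calc ((hsSpan n A).card : ℝ) * z ^ n
            ≤ (∑ m ∈ Finset.range (n + 1), ((brSpan m A).card : ℝ) * (hsSpanLT (n - m) A).card) * z ^ n :=
              mul_le_mul_of_nonneg_right h1 (pow_nonneg hz n)
          _ = _ := by
              rw [Finset.sum_mul]
              refine Finset.sum_congr rfl fun m hm => ?_
              rw [Finset.mem_range] at hm
              rw [show z ^ n = z ^ m * z ^ (n - m) by rw [← pow_add]; congr 1; omega]
              ring
    _ ≤ brGF M z A * hsLTGF M z A :=
        Zd.sum_range_triangle_le (f := fun m => ((brSpan m A).card : ℝ) * z ^ m)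
          (g := fun k => ((hsSpanLT k A).card : ℝ) * z ^ k)
          (fun i => by positivity) (fun i => by positivity) M

/-- `T_M(1) ≤ 1` (base of the induction on the span). [cite: MadrasSlade1993, §3.1, proof of Corollary 3.1.8] -/
theorem hsLTGF_one_le (M : ℕ) (z : ℝ) : hsLTGF M z 1 ≤ 1 := by
  classical
  rw [hsLTGF, Finset.sum_range_succ', pow_zero, mul_one]
  have h0 : ∀ n, ((hsSpanLT (n + 1) 1).card : ℝ) * z ^ (n + 1) = 0 := by
    intro n
    rw [mul_eq_zero]; left
    rw [Nat.cast_eq_zero, Finset.card_eq_zero, hsSpanLT, Finset.filter_eq_empty_iff]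
    intro ω hω hlt
    obtain ⟨hωs, hhs⟩ := mem_halfSpaceWalks.1 hω
    obtain ⟨h00, -, -, -⟩ := mem_saws_iff.1 hωs
    have h1 := hhs 1 le_rfl (by omega)
    have h2 := Zd.apply_le_maxLevel ω (show 1 ≤ n + 1 by omega)
    have h3 : ω 0 0 = 0 := by rw [h00]; rfl
    omega
  simp only [h0, Finset.sum_const_zero, zero_add]
  have : (hsSpanLT 0 1).card ≤ 1 := by
    calc (hsSpanLT 0 1).card ≤ (saws 0).card :=
          Finset.card_le_card fun ω hω => (mem_halfSpaceWalks.1 (Finset.mem_filter.1 hω).1).1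
      _ = 1 := by rw [card_saws, hexSawCount_zero]
  exact_mod_cast this

/-- **`T_M(A) ≤ exp(Σ_{1 ≤ a < A} V_M(a))`**, by induction on the span. [cite: MadrasSlade1993, §3.1, proof of Corollary 3.1.8] -/
theorem T_le_exp (M : ℕ) {z : ℝ} (hz : 0 ≤ z) (k : ℕ) :
    hsLTGF M z (k + 1 : ℕ) ≤ Real.exp (∑ a ∈ Finset.range k, brGF M z (a + 1 : ℕ)) := by
  induction k with
  | zero =>
    simp only [Nat.zero_add, Nat.cast_one, Finset.range_zero, Finset.sum_empty, Real.exp_zero]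
    exact hsLTGF_one_le M z
  | succ k ih =>
    have hT0 : 0 ≤ hsLTGF M z (k + 1 : ℕ) := Finset.sum_nonneg fun n _ => by positivity
    have hV0 : 0 ≤ brGF M z (k + 1 : ℕ) := Finset.sum_nonneg fun n _ => by positivity
    rw [Finset.sum_range_succ, Real.exp_add, show ((k + 1 + 1 : ℕ) : ℤ) = ((k + 1 : ℕ) : ℤ) + 1 by
      push_cast; ring, hsLTGF_succ]
    calc hsLTGF M z (k + 1 : ℕ) + ∑ n ∈ Finset.range (M + 1), ((hsSpan n (k + 1 : ℕ)).card : ℝ) * z ^ n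
        ≤ hsLTGF M z (k + 1 : ℕ) + brGF M z (k + 1 : ℕ) * hsLTGF M z (k + 1 : ℕ) := by
          gcongr
          exact sum_hsSpan_le M hz (by exact_mod_cast Nat.succ_pos k)
      _ = hsLTGF M z (k + 1 : ℕ) * (1 + brGF M z (k + 1 : ℕ)) := by ring
      _ ≤ Real.exp (∑ a ∈ Finset.range k, brGF M z (a + 1 : ℕ)) * Real.exp (brGF M z (k + 1 : ℕ)) := by
          gcongr
          linarith [Real.add_one_le_exp (brGF M z (k + 1 : ℕ))]

/-- `Σ_{1≤a≤A} V_M(a) ≤ B⁺_M(z)`. [cite: MadrasSlade1993, §3.1, proof of Corollary 3.1.8] -/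
theorem sum_brGF_le (M : ℕ) {z : ℝ} (hz : 0 ≤ z) (k : ℕ) :
    ∑ a ∈ Finset.range k, brGF M z (a + 1 : ℕ) ≤ bridgeGFpos M z := by
  classical
  simp only [brGF, bridgeGFpos]
  rw [Finset.sum_comm]
  refine Finset.sum_le_sum fun n hn => ?_
  rw [← Finset.sum_mul]
  split_ifs with hn0
  · subst hn0
    have : ∀ a ∈ Finset.range k, ((brSpan 0 (a + 1 : ℕ)).card : ℝ) = 0 := by
      intro a _
      rw [Nat.cast_eq_zero, Finset.card_eq_zero, brSpan, Finset.filter_eq_empty_iff]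
      intro ω hω h
      obtain ⟨h00, -, -, -⟩ := mem_saws_iff.1 (mem_bridges.1 hω).1
      rw [h00] at h
      simp at h
      omega
    rw [Finset.sum_congr rfl this, Finset.sum_const_zero, zero_mul]
  · refine mul_le_mul_of_nonneg_right ?_ (pow_nonneg hz n)
    have h1 : ∑ a ∈ Finset.range k, ((brSpan n (a + 1 : ℕ)).card : ℝ) =
        (((Finset.range k).biUnion fun a => brSpan n (a + 1 : ℕ)).card : ℝ) := by
      rw [Finset.card_biUnion]
      · push_cast; rfl
      · intro a _ b _ hab
        exact Finset.disjoint_filter.2 fun ω _ h1 h2 => hab (by push_cast at h1 h2; omega)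
    rw [h1]
    exact_mod_cast Finset.card_le_card (Finset.biUnion_subset.2 fun a _ => Finset.filter_subset _ _)

/-- **`Σ_{n≤M} h_n(ℍ) zⁿ ≤ exp(Σ_{1≤n≤M} b_n(ℍ) zⁿ)`** (`z ≥ 0`). [cite: MadrasSlade1993, §3.1, proof of Corollary 3.1.8] -/
theorem sum_halfSpaceCount_le_exp (M : ℕ) {z : ℝ} (hz : 0 ≤ z) :
    ∑ n ∈ Finset.range (M + 1), (halfSpaceCount n : ℝ) * z ^ n ≤ Real.exp (bridgeGFpos M z) := by
  classical
  have hT : ∑ n ∈ Finset.range (M + 1), (halfSpaceCount n : ℝ) * z ^ n = hsLTGF M z (M + 1 : ℕ) := by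
    refine Finset.sum_congr rfl fun n hn => ?_
    rw [Finset.mem_range] at hn
    congr 2
    rw [halfSpaceCount, hsSpanLT, Finset.filter_true_of_mem]
    intro ω hω
    obtain ⟨h00, -, hadj, -⟩ := Zd.mem_saws.1 (saws_subset n (mem_halfSpaceWalks.1 hω).1)
    have hml : Zd.maxLevel n ω ≤ (n : ℤ) := Zd.maxLevel_le fun i hi =>
      (le_abs_self _).trans ((Zd.abs_apply_le_of_adj h00 hadj i hi 0).trans (by exact_mod_cast hi))
    have hnM : (n : ℤ) < ((M + 1 : ℕ) : ℤ) := by exact_mod_cast hn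
    exact lt_of_le_of_lt hml hnM
  rw [hT]
  exact (T_le_exp M hz M).trans (Real.exp_le_exp.2 (sum_brGF_le M hz M))

/-- **Madras–Slade (3.1.13) on `ℍ`, finite form**: `Σ_{n≤M} c_n(ℍ) z^{n+1} ≤ exp(2 Σ_{1≤n≤M+1} b_n(ℍ) zⁿ)`
(`z ≥ 0`). [cite: MadrasSlade1993, §3.1, eq. (3.1.13); Hutchcroft2018HammersleyWelsh, Proposition 2.1] -/
theorem sum_hexSawCount_le_exp (M : ℕ) {z : ℝ} (hz : 0 ≤ z) :
    ∑ n ∈ Finset.range (M + 1), (hexSawCount n : ℝ) * z ^ (n + 1) ≤ Real.exp (2 * bridgeGFpos (M + 1) z) := by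
  set H : ℝ := ∑ n ∈ Finset.range (M + 2), (halfSpaceCount n : ℝ) * z ^ n with hH
  have hH0 : ∀ n, (0 : ℝ) ≤ (halfSpaceCount n : ℝ) * z ^ n := fun n => by positivity
  have hHexp : H ≤ Real.exp (bridgeGFpos (M + 1) z) := sum_halfSpaceCount_le_exp (M + 1) hz
  have hHnn : 0 ≤ H := Finset.sum_nonneg fun n _ => hH0 n
  have h1 : ∑ n ∈ Finset.range (M + 1), (hexSawCount n : ℝ) * z ^ (n + 1) ≤
      ∑ n ∈ Finset.range (M + 1), ∑ m ∈ Finset.range (n + 1),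
        ((halfSpaceCount (m + 1) : ℝ) * z ^ (m + 1)) * ((halfSpaceCount (n - m) : ℝ) * z ^ (n - m)) := by
    refine Finset.sum_le_sum fun n hn => ?_
    have hc : (hexSawCount n : ℝ) ≤ ∑ m ∈ Finset.range (n + 1),
        (halfSpaceCount (m + 1) : ℝ) * halfSpaceCount (n - m) := by
      exact_mod_cast hexSawCount_le_sum_halfSpaceCount_bw n
    calc (hexSawCount n : ℝ) * z ^ (n + 1)
        ≤ (∑ m ∈ Finset.range (n + 1), (halfSpaceCount (m + 1) : ℝ) * halfSpaceCount (n - m)) *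
            z ^ (n + 1) := mul_le_mul_of_nonneg_right hc (pow_nonneg hz _)
      _ = _ := by
          rw [Finset.sum_mul]
          refine Finset.sum_congr rfl fun m hm => ?_
          rw [Finset.mem_range] at hm
          rw [show z ^ (n + 1) = z ^ (m + 1) * z ^ (n - m) by rw [← pow_add]; congr 1; omega]
          ring
  have h2 := Zd.sum_range_triangle_le (f := fun m => (halfSpaceCount (m + 1) : ℝ) * z ^ (m + 1))
    (g := fun k => (halfSpaceCount k : ℝ) * z ^ k) (fun i => hH0 (i + 1)) (fun i => hH0 i) M
  have h3 : ∑ m ∈ Finset.range (M + 1), (halfSpaceCount (m + 1) : ℝ) * z ^ (m + 1) ≤ H := by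
    rw [hH, Finset.sum_range_succ' _ (M + 1)]
    linarith [hH0 0]
  have h4 : ∑ k ∈ Finset.range (M + 1), (halfSpaceCount k : ℝ) * z ^ k ≤ H := by
    rw [hH, Finset.sum_range_succ _ (M + 1)]
    linarith [hH0 (M + 1)]
  calc ∑ n ∈ Finset.range (M + 1), (hexSawCount n : ℝ) * z ^ (n + 1)
      ≤ _ := h1
    _ ≤ _ := h2
    _ ≤ H * H := mul_le_mul h3 h4 (Finset.sum_nonneg fun k _ => hH0 k) hHnn
    _ ≤ Real.exp (bridgeGFpos (M + 1) z) * Real.exp (bridgeGFpos (M + 1) z) :=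
        mul_le_mul hHexp hHexp hHnn (Real.exp_nonneg _)
    _ = Real.exp (2 * bridgeGFpos (M + 1) z) := by rw [← Real.exp_add]; ring_nf

/-- **Madras–Slade (3.1.14) at `z = 1/μ_ℍ`, finite form: `Σ_{n=1}^{M+1} b_n(ℍ) μ_ℍ^{-n} ≥ ½ log((M+1)/μ_ℍ)`.**
[cite: MadrasSlade1993, §3.1, eq. (3.1.14)] -/
theorem half_log_le_sum_bridgeCount (M : ℕ) :
    Real.log ((M + 1 : ℝ) / hexConnectiveConstant) / 2 ≤ bridgeGFpos (M + 1) hexConnectiveConstant⁻¹ := by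
  have hμ := hexConnectiveConstant_pos
  set z : ℝ := hexConnectiveConstant⁻¹ with hz
  have hz0 : 0 < z := inv_pos.2 hμ
  have h1 : ((M : ℝ) + 1) * z ≤ ∑ n ∈ Finset.range (M + 1), (hexSawCount n : ℝ) * z ^ (n + 1) := by
    have : ∀ n ∈ Finset.range (M + 1), z ≤ (hexSawCount n : ℝ) * z ^ (n + 1) := by
      intro n _
      have hc := hexConnectiveConstant_pow_le n
      have hzn : z ^ n * hexConnectiveConstant ^ n = 1 := by
        rw [hz, ← mul_pow, inv_mul_cancel₀ hμ.ne', one_pow]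
      calc z = z * (z ^ n * hexConnectiveConstant ^ n) := by rw [hzn, mul_one]
        _ ≤ z * (z ^ n * hexSawCount n) := by gcongr
        _ = (hexSawCount n : ℝ) * z ^ (n + 1) := by ring
    calc ((M : ℝ) + 1) * z = ∑ _n ∈ Finset.range (M + 1), z := by
          rw [Finset.sum_const, Finset.card_range, nsmul_eq_mul]; push_cast; ring
      _ ≤ _ := Finset.sum_le_sum this
  have h2 := sum_hexSawCount_le_exp M hz0.le
  have h3 : ((M : ℝ) + 1) * z ≤ Real.exp (2 * bridgeGFpos (M + 1) z) := h1.trans h2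
  have h4 : Real.log (((M : ℝ) + 1) * z) ≤ 2 * bridgeGFpos (M + 1) z := by
    rw [← Real.log_exp (2 * bridgeGFpos (M + 1) z)]
    exact Real.log_le_log (by positivity) h3
  rw [div_eq_mul_inv ((M : ℝ) + 1), ← hz]
  linarith

/-- **The brick-wall bridge generating function of `ℍ` diverges at `z = 1/μ_ℍ`:
`Σ_n b_n(ℍ) μ_ℍ^{-n} = +∞`** (Kesten 1963; Madras–Slade Corollary 3.1.8 on the honeycomb lattice) — the partial
sums exceed `½ log((M+1)/μ_ℍ) → ∞`. Input K4 of the lane's route R84 (one-step half-space ratio on `ℍ`).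
[cite: MadrasSlade1993, Corollary 3.1.8, eq. (3.1.11) (p. 61); Kesten1963SAW] -/
theorem not_summable_bridgeCount_div_pow :
    ¬ Summable (fun n => (bridgeCount n : ℝ) / hexConnectiveConstant ^ n) := by
  intro hsum
  have hμ := hexConnectiveConstant_pos
  set S : ℝ := ∑' N : ℕ, (bridgeCount N : ℝ) / hexConnectiveConstant ^ N with hS
  have hnn : ∀ N, 0 ≤ (bridgeCount N : ℝ) / hexConnectiveConstant ^ N := fun N => by positivity
  have hle : ∀ M, bridgeGFpos (M + 1) hexConnectiveConstant⁻¹ ≤ S := by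
    intro M
    calc bridgeGFpos (M + 1) hexConnectiveConstant⁻¹
        ≤ ∑ N ∈ Finset.range (M + 2), (bridgeCount N : ℝ) / hexConnectiveConstant ^ N := by
          refine Finset.sum_le_sum fun N _ => ?_
          split_ifs
          · exact hnn N
          · rw [div_eq_mul_inv, inv_pow]
      _ ≤ S := hsum.sum_le_tsum _ (fun N _ => hnn N)
  obtain ⟨M, hM⟩ : ∃ M : ℕ, Real.exp (2 * S) * hexConnectiveConstant < (M : ℝ) + 1 :=
    ⟨Nat.ceil (Real.exp (2 * S) * hexConnectiveConstant), (Nat.le_ceil _).trans_lt (by linarith)⟩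
  have h1 := (half_log_le_sum_bridgeCount M).trans (hle M)
  have h2 : Real.log (((M : ℝ) + 1) / hexConnectiveConstant) ≤ 2 * S := by linarith
  have h3 : ((M : ℝ) + 1) / hexConnectiveConstant ≤ Real.exp (2 * S) := by
    rw [← Real.exp_log (show 0 < ((M : ℝ) + 1) / hexConnectiveConstant by positivity)]
    exact Real.exp_le_exp.2 h2
  rw [div_le_iff₀ hμ] at h3
  linarith

end HexBW

end Literature.Probability.RandomPlanarGeometry.SAW
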